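import Mathlib
import Summits.CriticalPhenomena.CardyFormulaZ2.Theorems.CardySelfRefinementGradientComparabilityStubBoundaryValuesLo
import HarnessLib

/-!
# Boundary values of the crossing probability of the self-refinement model

Crux `stmt-CriticalPhenomena-10269`
(`Summit.CriticalPhenomena.CardyFormulaZ2.Theses.CardySelfRefinement.GradientComparability`),
line **Sketch**, stub `stub_boundaryValues` (BV).

## Mathematics

For the self-refinement model `M_k(ρ, c)` (`k = 2, 3`; vocabulary `M`, `P`, `A` of
`CardySelfRefinementDefs`) and a nonempty finite quad family `F` at mesh `η`:

* at `c = 1` every interior edge is almost surely open, the rows and columns off the coarse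
  lattice `kℤ²` are entirely open and cross every tube rectangle of every quad, so every quad is
  crossed: `P k m F η ρ 1 = 1 > vhi` for all small `η` and all `ρ`
  (`P_one_eq_one_eventually`, file `…StubBoundaryValuesHi`);
* at `c = 0` only the axial skeleton can be open; a crossing of the first quad forces a long open
  skeleton walk, hence a long arm of the *coarse shadow*, an independent bond percolation of
  parameter `q(ρ) = ρ̂/2 + (1 - ρ̂)/4 ≤ 1/2 - δ/4 < p_c(ℤ²) = 1/2` for `ρ ≤ 1 - δ`; by subcritical
  sharpness (Kesten, Menshikov, Aizenman–Barsky, Duminil-Copin–Tassion) and a union bound over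
  `O(η⁻²)` starting points, `P k m F η ρ 0 → 0` uniformly in `ρ ∈ [0, 1 - δ]`
  (`P_zero_lt_eventually`, files `…StubBoundaryValuesSkeleton`, `…Coupling`, `…Lo`).
-/

noncomputable section

namespace Summit.CriticalPhenomena.CardyFormulaZ2.Theorems.CardySelfRefinement

open scoped Topology
open Filter Set MeasureTheory
open Literature.Probability.LatticeModels Literature.Probability.Percolation
open Literature.Probability.Percolation.QuadCrossing
open Summit.CriticalPhenomena.CardyFormulaZ2.Theses.CardySelfRefinement

/-- **(BV) Boundary values.**  For `k = 2, 3`, a nonempty finite quad family, `0 < δ ≤ 1/2` and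
levels `0 < vlo < vhi < 1`: for all meshes `η` below a threshold and all `ρ ∈ [0, 1 - δ]`, the
joint crossing probability of `M_k(ρ, c)` is `< vlo` at `c = 0` and `> vhi` at `c = 1` (it is
in fact `1` there).  The admissible path `γ` plays no role. -/
theorem stub_boundaryValues :
    ∀ k : ℕ, k = 2 ∨ k = 3 → ∀ γ : unitInterval → ℝ × ℝ, PathOK k γ →
      ∀ (m : ℕ) (F : Fin m → Quad (Set.univ : Set ℂ)), 0 < m → ∀ δ : ℝ, 0 < δ → δ ≤ 1 / 2 →
        ∀ vlo vhi : ℝ, 0 < vlo → vlo < vhi → vhi < 1 →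
          ∃ η₁ : ℝ, 0 < η₁ ∧ ∀ η ∈ Set.Ioo 0 η₁,
            ∀ ρ ∈ Set.Icc (0 : ℝ) (1 - δ), P k m F η ρ 0 < vlo ∧ vhi < P k m F η ρ 1 := by
  intro k hk γ _ m F hm δ hδ hδ2 vlo vhi hvlo _ hvhi
  have h := (P_zero_lt_eventually hk F hm hδ hδ2 hvlo).and (P_one_eq_one_eventually hk m F)
  rw [eventually_nhdsWithin_iff, Metric.eventually_nhds_iff] at h
  obtain ⟨ε, hε, hall⟩ := h
  refine ⟨ε, hε, fun η hη ρ hρ => ?_⟩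
  obtain ⟨hlo, hhi⟩ := hall (by rw [Real.dist_eq, sub_zero, abs_of_pos hη.1]; exact hη.2) hη.1
  exact ⟨hlo ρ hρ, by rw [hhi ρ]; exact hvhi⟩

end Summit.CriticalPhenomena.CardyFormulaZ2.Theorems.CardySelfRefinement

end
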